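import Literature.Geometry.ComplexAnalytic.CyclicNodePencilRadiusCutoff
import HarnessLib

/-!
# The saturated Morse radius of the nodal pencil: a global `C^∞` defect function `κ` with `R'' − κ = Σ|Θ y|²` on the inner region

Family `hodge`, layer `Literature/Geometry/ComplexAnalytic`; companion of `CyclicNodePencilRadiusCutoff`. The cut-off radius
`morseRadiusCutoff` decays to `0` far from the node, so its SMALL values do not single out the Morse shells. For the slab / first-integral
arguments (`Geometry/Manifold/IntegralCurveSlab`) one wants instead a function which is the radius `Σ|Θ y|²` where this is `≤ R'''` and is
LARGE (`≥ R'''`) everywhere else: `R'' − κ(y)` with the DEFECT `κ(y) = (R'' − Σ|Θ y|²)·σ(Σ|Θ y|²)` on `Θ.source` (`σ` the smooth step equal to `1`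
below `R'''` and `0` above `R''`) and `κ = 0` off the source. `κ` is `C^∞` with compact support in `Θ.source` (when `{Σ|z|² ≤ R''} ⊆ Θ.target`),
so `R'' − κ ∘ y` extends by the constant `R''` to the whole ambient manifold.

* `radiusDefect Θ R''' R''` — `κ`; `radiusDefect_of_le` (`κ = R'' − Σ` where `Σ ≤ R'''`), `radiusDefect_of_ge` (`κ = 0` where `Σ ≥ R''`),
  `radiusDefect_of_not_mem` (`κ = 0` off the source), `sub_radiusDefect_ge` (`R'' − κ ≥ Σ` hence `≥ R'''` where `Σ ≥ R'''`),
  `lt_of_sub_radiusDefect_lt` (`R'' − κ(y) < R''' ⇒ y ∈ Θ.source ∧ Σ|Θ y|² = R'' − κ(y)`);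
* `contDiff_radiusDefect`, `radiusDefect_eventuallyEq`, `exists_bound_radiusDefect`.

Everything is proved; the one definition is concrete; no named facts.

## References

* [BrockerJanichIDT1982] T. Bröcker, K. Jänich, Introduction to Differential Topology (1982), §7 (bump functions).
* [Milnor1968] J. Milnor, Singular Points of Complex Hypersurfaces (1968), §5.
-/

noncomputable section

open Set Filter Topology Function
open scoped ContDiff

namespace Literature.Geometry.ComplexAnalytic

namespace PhamBrieskorn

variable (Θ : OpenPartialHomeomorph (Fin (1 + 2) → ℂ) (Fin (1 + 2) → ℂ)) (R''' R'' : ℝ)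

open scoped Classical in
/-- **The radius defect** `κ(y) = (R'' − Σ|Θ y|²)·σ(Σ|Θ y|²)` on `Θ.source` (`σ = smoothTransition((R'' − u)/(R'' − R'''))`), `0` off it.
[cite: BrockerJanichIDT1982, §7] -/
def radiusDefect (y : Fin (1 + 2) → ℂ) : ℝ :=
  if y ∈ Θ.source then
    (R'' - ∑ i, ‖Θ y i‖ ^ 2) * Real.smoothTransition ((R'' - ∑ i, ‖Θ y i‖ ^ 2) / (R'' - R'''))
  else 0

/-- On the source the defect is the product formula. [cite: BrockerJanichIDT1982, §7] -/
theorem radiusDefect_of_mem {y : Fin (1 + 2) → ℂ} (hy : y ∈ Θ.source) :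
    radiusDefect Θ R''' R'' y =
      (R'' - ∑ i, ‖Θ y i‖ ^ 2) * Real.smoothTransition ((R'' - ∑ i, ‖Θ y i‖ ^ 2) / (R'' - R''')) := by
  classical
  simp [radiusDefect, hy]

/-- Off the source the defect vanishes. [cite: BrockerJanichIDT1982, §7] -/
theorem radiusDefect_of_not_mem {y : Fin (1 + 2) → ℂ} (hy : y ∉ Θ.source) : radiusDefect Θ R''' R'' y = 0 := by
  classical
  simp [radiusDefect, hy]

/-- **Where `Σ ≤ R'''` the saturated radius `R'' − κ` IS the radius** (`R''' < R''`). [cite: BrockerJanichIDT1982, §7] -/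
theorem radiusDefect_of_le (hR : R''' < R'') {y : Fin (1 + 2) → ℂ} (hy : y ∈ Θ.source) (hle : ∑ i, ‖Θ y i‖ ^ 2 ≤ R''') :
    radiusDefect Θ R''' R'' y = R'' - ∑ i, ‖Θ y i‖ ^ 2 := by
  rw [radiusDefect_of_mem Θ R''' R'' hy, Real.smoothTransition.one_of_one_le, mul_one]
  rw [le_div_iff₀ (sub_pos.mpr hR), one_mul]
  linarith

/-- Where `Σ ≥ R''` (inside the source) the defect vanishes (`R''' < R''`). [cite: BrockerJanichIDT1982, §7] -/
theorem radiusDefect_of_ge (hR : R''' < R'') {y : Fin (1 + 2) → ℂ} (hy : y ∈ Θ.source) (hge : R'' ≤ ∑ i, ‖Θ y i‖ ^ 2) :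
    radiusDefect Θ R''' R'' y = 0 := by
  rw [radiusDefect_of_mem Θ R''' R'' hy, Real.smoothTransition.zero_of_nonpos, mul_zero]
  exact div_nonpos_of_nonpos_of_nonneg (by linarith) (sub_pos.mpr hR).le

/-- **The saturated radius dominates the radius on the source**: `R'' − κ(y) ≥ Σ|Θ y|²` when `Σ|Θ y|² ≤ R''`; in general
`R'' − κ(y) ≥ min R'' (Σ|Θ y|²)` on the source. [cite: BrockerJanichIDT1982, §7] -/
theorem min_le_sub_radiusDefect (hR : R''' < R'') {y : Fin (1 + 2) → ℂ} (hy : y ∈ Θ.source) :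
    min R'' (∑ i, ‖Θ y i‖ ^ 2) ≤ R'' - radiusDefect Θ R''' R'' y := by
  rw [radiusDefect_of_mem Θ R''' R'' hy]
  set u := ∑ i, ‖Θ y i‖ ^ 2 with hu
  have h0 := Real.smoothTransition.nonneg ((R'' - u) / (R'' - R'''))
  have h1 := Real.smoothTransition.le_one ((R'' - u) / (R'' - R'''))
  rcases le_total u R'' with hle | hge
  · rw [min_eq_right hle]
    nlinarith
  · rw [min_eq_left hge]
    have : Real.smoothTransition ((R'' - u) / (R'' - R''')) = 0 :=
      Real.smoothTransition.zero_of_nonpos (div_nonpos_of_nonpos_of_nonneg (by linarith) (sub_pos.mpr hR).le)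
    rw [this, mul_zero, sub_zero]

/-- **Small values of the saturated radius detect the inner region**: if `R'' − κ(y) < R'''` (`R''' < R''`) then `y ∈ Θ.source` and
`Σ|Θ y|² = R'' − κ(y)` (`< R'''`). [cite: BrockerJanichIDT1982, §7] -/
theorem lt_of_sub_radiusDefect_lt (hR : R''' < R'') {y : Fin (1 + 2) → ℂ} (hlt : R'' - radiusDefect Θ R''' R'' y < R''') :
    y ∈ Θ.source ∧ ∑ i, ‖Θ y i‖ ^ 2 = R'' - radiusDefect Θ R''' R'' y := by
  have hy : y ∈ Θ.source := by
    by_contra h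
    rw [radiusDefect_of_not_mem Θ R''' R'' h, sub_zero] at hlt
    exact absurd hlt (not_lt.mpr hR.le)
  refine ⟨hy, ?_⟩
  have hmin := min_le_sub_radiusDefect Θ R''' R'' hR hy
  have hu : ∑ i, ‖Θ y i‖ ^ 2 ≤ R''' := by
    by_contra h
    have h' : R''' < ∑ i, ‖Θ y i‖ ^ 2 := not_le.mp h
    have : R''' < min R'' (∑ i, ‖Θ y i‖ ^ 2) := lt_min (hR.trans_le le_rfl) h'
    linarith
  rw [radiusDefect_of_le Θ R''' R'' hR hy hu]
  ring

/-- The support of the defect lies in `Θ.symm '' (Θ.target ∩ {Σ|zᵢ|² ≤ R''})` (`R''' < R''`). [cite: BrockerJanichIDT1982, §7] -/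
theorem support_radiusDefect_subset (hR : R''' < R'') :
    Function.support (radiusDefect Θ R''' R'') ⊆ Θ.symm '' (Θ.target ∩ {z | ∑ i, ‖z i‖ ^ 2 ≤ R''}) := by
  intro y hy
  rw [Function.mem_support] at hy
  have hys : y ∈ Θ.source := by
    by_contra h
    exact hy (radiusDefect_of_not_mem Θ R''' R'' h)
  have hlt : ∑ i, ‖Θ y i‖ ^ 2 < R'' := by
    by_contra h
    exact hy (radiusDefect_of_ge Θ R''' R'' hR hys (not_lt.mp h))
  exact ⟨Θ y, ⟨Θ.map_source hys, hlt.le⟩, Θ.left_inv hys⟩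

/-- **The topological support of the defect is compact and inside `Θ.source`** (`R''' < R''`, `{Σ|zᵢ|² ≤ R''} ⊆ Θ.target`).
[cite: BrockerJanichIDT1982, §7] -/
theorem tsupport_radiusDefect_subset (hR : R''' < R'') (hR'' : {z : Fin (1 + 2) → ℂ | ∑ i, ‖z i‖ ^ 2 ≤ R''} ⊆ Θ.target) :
    tsupport (radiusDefect Θ R''' R'') ⊆ Θ.symm '' (Θ.target ∩ {z | ∑ i, ‖z i‖ ^ 2 ≤ R''}) ∧
      tsupport (radiusDefect Θ R''' R'') ⊆ Θ.source := by
  obtain ⟨hc, hsub⟩ := isCompact_symm_image_radius_le Θ R'' hR''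
  have h1 : tsupport (radiusDefect Θ R''' R'') ⊆ Θ.symm '' (Θ.target ∩ {z | ∑ i, ‖z i‖ ^ 2 ≤ R''}) :=
    closure_minimal (support_radiusDefect_subset Θ R''' R'' hR) hc.isClosed
  exact ⟨h1, h1.trans hsub⟩

/-- **The defect is `C^∞` on `ℂ³`.** [cite: BrockerJanichIDT1982, §7] -/
theorem contDiff_radiusDefect (hΘ : ContDiffOn ℝ ∞ Θ Θ.source) (hR : R''' < R'')
    (hR'' : {z : Fin (1 + 2) → ℂ | ∑ i, ‖z i‖ ^ 2 ≤ R''} ⊆ Θ.target) :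
    ContDiff ℝ ∞ (radiusDefect Θ R''' R'') := by
  rw [contDiff_iff_contDiffAt]
  intro y
  by_cases hy : y ∈ tsupport (radiusDefect Θ R''' R'')
  · have hys : y ∈ Θ.source := (tsupport_radiusDefect_subset Θ R''' R'' hR hR'').2 hy
    have hr : ContDiffAt ℝ ∞ (fun y : Fin (1 + 2) → ℂ => ∑ i, ‖Θ y i‖ ^ 2) y := by
      have hΘy : ContDiffAt ℝ ∞ (Θ : (Fin (1 + 2) → ℂ) → Fin (1 + 2) → ℂ) y := hΘ.contDiffAt (Θ.open_source.mem_nhds hys)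
      refine ContDiffAt.sum fun i _ => ?_
      exact ((contDiffAt_apply ℝ ℂ i (Θ y)).comp y hΘy).norm_sq ℝ
    have hprod : ContDiffAt ℝ ∞ (fun y : Fin (1 + 2) → ℂ =>
        (R'' - ∑ i, ‖Θ y i‖ ^ 2) * Real.smoothTransition ((R'' - ∑ i, ‖Θ y i‖ ^ 2) / (R'' - R'''))) y :=
      (contDiffAt_const.sub hr).mul ((Real.smoothTransition.contDiff.contDiffAt).comp y ((contDiffAt_const.sub hr).div_const _))
    refine hprod.congr_of_eventuallyEq ?_
    filter_upwards [Θ.open_source.mem_nhds hys] with y' hy'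
    exact radiusDefect_of_mem Θ R''' R'' hy'
  · rw [notMem_tsupport_iff_eventuallyEq] at hy
    exact contDiffAt_const.congr_of_eventuallyEq hy

/-- **Near a point `y₀ ∈ Θ.source` with `Σ|Θ y₀|² < R'''` the saturated radius is the radius** (as germs):
`R'' − κ =ᶠ Σ|Θ ·|²`. [cite: BrockerJanichIDT1982, §7] -/
theorem sub_radiusDefect_eventuallyEq (hR : R''' < R'') {y₀ : Fin (1 + 2) → ℂ} (hy₀ : y₀ ∈ Θ.source)
    (hlt : ∑ i, ‖Θ y₀ i‖ ^ 2 < R''') :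
    (fun y => R'' - radiusDefect Θ R''' R'' y) =ᶠ[𝓝 y₀] fun y => ∑ i, ‖Θ y i‖ ^ 2 := by
  have hcont : ContinuousAt (fun y : Fin (1 + 2) → ℂ => ∑ i, ‖Θ y i‖ ^ 2) y₀ := by
    have hΘc : ContinuousAt (Θ : (Fin (1 + 2) → ℂ) → Fin (1 + 2) → ℂ) y₀ := Θ.continuousAt hy₀
    refine tendsto_finsetSum _ fun i _ => ?_
    exact ((continuous_apply i).continuousAt.comp hΘc).norm.pow 2
  have hlt' : ∀ᶠ y in 𝓝 y₀, ∑ i, ‖Θ y i‖ ^ 2 < R''' := hcont.eventually (gt_mem_nhds hlt)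
  filter_upwards [hlt', Θ.open_source.mem_nhds hy₀] with y hy hys
  rw [radiusDefect_of_le Θ R''' R'' hR hys hy.le]
  ring

/-- **The defect vanishes outside a norm ball** (compact support). [cite: BrockerJanichIDT1982, §7] -/
theorem exists_bound_radiusDefect (hR : R''' < R'') (hR'' : {z : Fin (1 + 2) → ℂ | ∑ i, ‖z i‖ ^ 2 ≤ R''} ⊆ Θ.target) :
    ∃ R : ℝ, ∀ y : Fin (1 + 2) → ℂ, R < ‖y‖ → radiusDefect Θ R''' R'' y = 0 := by
  obtain ⟨hc, -⟩ := isCompact_symm_image_radius_le Θ R'' hR''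
  obtain ⟨R, hRb⟩ := hc.isBounded.subset_closedBall (0 : Fin (1 + 2) → ℂ)
  refine ⟨R, fun y hy => ?_⟩
  by_contra hne
  have hmem := support_radiusDefect_subset Θ R''' R'' hR (Function.mem_support.mpr hne)
  have := hRb hmem
  rw [Metric.mem_closedBall, dist_zero_right] at this
  exact absurd hy (not_lt.mpr this)

end PhamBrieskorn

end Literature.Geometry.ComplexAnalytic

end
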